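import Mathlib
import Summits.Ventures.PercRepro2.CrossAPrimeVMarkedPendantRoot
import Summits.Ventures.PercRepro2.CrossAPrimeVMarkedCutMark

/-!
# A two-route mark: the connectivity lemmas
(blind cell PercRepro2, p5 g41; S4 §2.4 (s) addendum 61 — part 1 of `CrossAPrimeVMarkedTwoRoute`)

The hard regime of the candidate `VMarkedVdBK p ends a₁ v o b` (row 2′VMARK, (★₂′)) is the one where
`v` is more correlated with each of `o`, `b` than they are with each other (addendum 59 (1)); its
purest form is a mark `v` whose only edges are `fo = {v, o}` and `fb = {v, b}` — the 4-cycle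
`a₁–o–v–b–a₁` (`v` opposite the root) is one of the two smallest instances of the open class (the
other, `a₁–o–b–v–a₁` with `v` adjacent to the root, is `CrossAPrimeVMarkedRootRoute`).  This file
proves (★₂′) for EVERY such instance, with any graph `G − v` around it: writing `ω₀` for `ω` with
`fo`, `fb` closed (`Function.update (Function.update ω fo false) fb false`) and
`O = {o ∈ C(a₁) in ω₀}`, `B = {b ∈ C(a₁) in ω₀}` (events of `G − v`,
independent of the two coins),

  `o ∈ A ⟺ O ∨ (fo ∧ fb ∧ B)`, `b ∈ A ⟺ B ∨ (fo ∧ fb ∧ O)`, `v ∈ A ⟺ (fo ∧ O) ∨ (fb ∧ B)`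

(`conn_twoRoute_o / _b / _v`), so with `α = p fo`, `β = p fb` and the cells `a₀ = P(Oᶜ ∩ Bᶜ)`,
`p₀ = P(Oᶜ ∩ B)`, `q₀ = P(O ∩ Bᶜ)`, `r₀ = P(O ∩ B)` of `G − v`:

  `RHS − LHS = αβ·a₀·[p₀ + q₀ + r₀(1 + α + β − 2αβ)] + (a₀r₀ − p₀q₀)·(1 − αβ)·(α + β − 2αβ) ≥ 0`

by Harris on `G − v` (`a₀r₀ ≥ p₀q₀`) — `vMarkedVdBK_of_twoRoute`.  Own work; standard axioms.
-/

namespace Summit.Ventures.PercRepro2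

open CrossAPrimeVMarked CrossAPrimeVMarkedCut CrossAPrimeVMarkedLeaf CrossAPrimeIsolatedFlip OneEdge
  CrossAPrimeVMarkedPendantRoot CrossAPrimeVMarkedCutMark

namespace CrossAPrimeVMarkedTwoRoute

variable {V : Type*} {E : Type*} [Fintype E] [DecidableEq E] [Fintype V] [DecidableEq V]
  {R : Type*} [Field R] [LinearOrder R] [IsStrictOrderedRing R]
variable {ends : E → Sym2 V}

section Close

variable (fo fb : E)

omit [Fintype E] [Fintype V] [DecidableEq V] in
/-- `update (update · fo false) fb false` closes `fo`. -/
@[simp] lemma closeTwo_apply_fo (ω : Config E) (hne : fo ≠ fb) :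
    Function.update (Function.update ω fo false) fb false fo = false := by
  simp [Function.update_of_ne hne]

omit [Fintype E] [Fintype V] [DecidableEq V] in
/-- `update (update · fo false) fb false` closes `fb`. -/
@[simp] lemma closeTwo_apply_fb (ω : Config E) :
    Function.update (Function.update ω fo false) fb false fb = false := by
  simp

omit [Fintype E] [Fintype V] [DecidableEq V] in
/-- `update (update · fo false) fb false` leaves the other edges alone. -/
lemma closeTwo_apply_of_ne (ω : Config E) {e : E} (ho : e ≠ fo) (hb : e ≠ fb) :
    Function.update (Function.update ω fo false) fb false e = ω e := by
  simp [Function.update_of_ne ho, Function.update_of_ne hb]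

omit [Fintype E] [Fintype V] [DecidableEq V] in
/-- `update (update · fo false) fb false` is monotone. -/
lemma closeTwo_mono {ω ω' : Config E} (h : ω ≤ ω') :
    Function.update (Function.update ω fo false) fb false ≤
      Function.update (Function.update ω' fo false) fb false := by
  intro e
  by_cases hb : e = fb
  · subst hb; simp
  · by_cases ho : e = fo
    · subst ho; simp [Function.update_of_ne hb]
    · rw [closeTwo_apply_of_ne fo fb ω ho hb, closeTwo_apply_of_ne fo fb ω' ho hb]
      exact h e

omit [Fintype E] [Fintype V] [DecidableEq V] in
/-- Two configurations agreeing off `{fo, fb}` agree after `update (update · fo false) fb false`. -/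
lemma closeTwo_eq_of_agree {ω ω' : Config E} (h : ∀ e ∈ ({fo, fb} : Set E)ᶜ, ω e = ω' e) :
    Function.update (Function.update ω fo false) fb false =
      Function.update (Function.update ω' fo false) fb false := by
  funext e
  by_cases hb : e = fb
  · subst hb; simp
  · by_cases ho : e = fo
    · subst ho; simp [Function.update_of_ne hb]
    · rw [closeTwo_apply_of_ne fo fb ω ho hb, closeTwo_apply_of_ne fo fb ω' ho hb]
      exact h e (by simp [ho, hb])

omit [Fintype E] [Fintype V] [DecidableEq V] in
/-- `update (update · fo false) fb false` is idempotent-like: closing again changes nothing. -/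
lemma closeTwo_closeTwo (ω : Config E) :
    Function.update (Function.update (Function.update (Function.update ω fo false) fb false) fo false)
        fb false =
      Function.update (Function.update ω fo false) fb false := by
  funext e
  by_cases hb : e = fb
  · subst hb; simp
  · by_cases ho : e = fo
    · subst ho; simp [Function.update_of_ne hb]
    · rw [closeTwo_apply_of_ne fo fb _ ho hb, closeTwo_apply_of_ne fo fb ω ho hb]

omit [Fintype E] [Fintype V] [DecidableEq V] in
/-- An event of the form `{ω | ω₀ ∈ A}` (`ω₀` = `ω` with `fo`, `fb` closed) is determined by the other
edges. -/
lemma dependsOn_closeTwo (A : Set (Config E)) :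
    DependsOn (· ∈ {ω : Config E | Function.update (Function.update ω fo false) fb false ∈ A})
      (({fo, fb} : Set E)ᶜ) := by
  intro ω ω' h
  simp only [Set.mem_setOf_eq]
  rw [closeTwo_eq_of_agree fo fb h]

omit [Fintype E] [Fintype V] [DecidableEq V] in
/-- Reconstruction: `ω` is `ω₀` (`ω` with `fo`, `fb` closed) with the two edges re-opened as in `ω`. -/
lemma eq_update_update_closeTwo (ω : Config E) (hne : fo ≠ fb) :
    ω = Function.update (Function.update (Function.update (Function.update ω fo false) fb false) fo
      (ω fo)) fb (ω fb) := by
  funext e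
  by_cases hb : e = fb
  · subst hb; simp
  · rw [Function.update_of_ne hb]
    by_cases ho : e = fo
    · subst ho; simp
    · rw [Function.update_of_ne ho, closeTwo_apply_of_ne fo fb ω ho hb]

end Close

section Conn

variable {fo fb : E} {a₁ v o b : V}

omit [Fintype E] [Fintype V] [DecidableEq V] in
/-- In a configuration whose only open edge at `v` is `fo = {v, o}`: connections among vertices other
than `v` are those with `fo` closed, and `v ↔ x` iff `o ↔ x` (`x ≠ v`). -/
lemma conn_pendant_update {σ : Config E} (hfo : ends fo = s(v, o))
    (hiso : ∀ e, v ∈ ends e → σ e = false) (hov : o ≠ v) :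
    (∀ x y : V, x ≠ v → y ≠ v →
        (Conn ends (Function.update σ fo true) x y ↔ Conn ends σ x y)) ∧
      (∀ x : V, x ≠ v → (Conn ends (Function.update σ fo true) v x ↔ Conn ends σ o x)) := by
  have hfo' : ends fo = s(o, v) := by rw [hfo, Sym2.eq_swap]
  refine ⟨fun x y hx hy => conn_update_true_iff_of_isolated hfo' hiso hx hy, fun x hx => ?_⟩
  rw [conn_update_true_iff hfo σ v x]
  constructor
  · rintro (h | ⟨-, h⟩ | ⟨h, -⟩)
    · exact absurd (eq_of_conn_of_isolated hiso h) hx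
    · exact h
    · exact absurd (eq_of_conn_of_isolated hiso h) hov
  · intro h
    exact Or.inr (Or.inl ⟨conn_refl ends σ v, h⟩)

omit [Fintype E] [Fintype V] [DecidableEq V] in
/-- Both routes open: `a₁ ↔ o` iff `a₁ ↔ o` or `a₁ ↔ b` with the routes closed (and symmetrically),
and `a₁ ↔ v` iff one of them. -/
lemma conn_both_open {σ : Config E} (hfo : ends fo = s(v, o)) (hfb : ends fb = s(v, b))
    (hiso : ∀ e, v ∈ ends e → σ e = false) (hav : a₁ ≠ v) (hov : o ≠ v) (hbv : b ≠ v) :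
    (Conn ends (Function.update (Function.update σ fo true) fb true) a₁ o ↔
        Conn ends σ a₁ o ∨ Conn ends σ a₁ b) ∧
      (Conn ends (Function.update (Function.update σ fo true) fb true) a₁ b ↔
        Conn ends σ a₁ b ∨ Conn ends σ a₁ o) ∧
      (Conn ends (Function.update (Function.update σ fo true) fb true) a₁ v ↔
        Conn ends σ a₁ o ∨ Conn ends σ a₁ b) := by
  have P := conn_pendant_update hfo hiso hov
  set σ₁ := Function.update σ fo true with hσ₁
  have e_ao : Conn ends σ₁ a₁ o ↔ Conn ends σ a₁ o := P.1 a₁ o hav hov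
  have e_ab : Conn ends σ₁ a₁ b ↔ Conn ends σ a₁ b := P.1 a₁ b hav hbv
  have e_bo : Conn ends σ₁ b o ↔ Conn ends σ b o := P.1 b o hbv hov
  have e_vo : Conn ends σ₁ v o ↔ Conn ends σ o o := P.2 o hov
  have e_vb : Conn ends σ₁ v b ↔ Conn ends σ o b := P.2 b hbv
  have e_av : Conn ends σ₁ a₁ v ↔ Conn ends σ o a₁ := by
    rw [← P.2 a₁ hav]
    exact ⟨conn_symm, conn_symm⟩
  refine ⟨?_, ?_, ?_⟩
  · rw [conn_update_true_iff hfb σ₁ a₁ o, e_ao, e_av, e_bo, e_ab, e_vo]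
    constructor
    · rintro (h | ⟨h, -⟩ | ⟨h, -⟩)
      · exact Or.inl h
      · exact Or.inl (conn_symm h)
      · exact Or.inr h
    · rintro (h | h)
      · exact Or.inl h
      · exact Or.inr (Or.inr ⟨h, conn_refl ends σ o⟩)
  · rw [conn_update_true_iff hfb σ₁ a₁ b, e_ab, e_av, e_vb]
    constructor
    · rintro (h | ⟨h, -⟩ | ⟨h, -⟩)
      · exact Or.inl h
      · exact Or.inr (conn_symm h)
      · exact Or.inl h
    · rintro (h | h)
      · exact Or.inl h
      · exact Or.inr (Or.inl ⟨conn_symm h, conn_refl ends σ₁ b⟩)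
  · rw [conn_update_true_iff hfb σ₁ a₁ v, e_av, e_ab]
    constructor
    · rintro (h | ⟨h, -⟩ | ⟨h, -⟩)
      · exact Or.inl (conn_symm h)
      · exact Or.inl (conn_symm h)
      · exact Or.inr h
    · rintro (h | h)
      · exact Or.inl (conn_symm h)
      · exact Or.inr (Or.inr ⟨h, conn_refl ends σ₁ v⟩)

omit [Fintype E] [Fintype V] [DecidableEq V] in
/-- The closed-routes configuration has `v` isolated. -/
lemma closeTwo_isolated (hv : ∀ e, v ∈ ends e → e = fo ∨ e = fb) (hne : fo ≠ fb) (ω : Config E) :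
    ∀ e, v ∈ ends e → Function.update (Function.update ω fo false) fb false e = false := by
  intro e he
  rcases hv e he with h | h <;> rw [h]
  · exact closeTwo_apply_fo fo fb ω hne
  · exact closeTwo_apply_fb fo fb ω

omit [Fintype E] [Fintype V] [DecidableEq V] in
/-- The four reconstructions of `ω` from `ω₀` (`ω` with `fo`, `fb` closed) by the two coin values. -/
lemma eq_of_coins (hne : fo ≠ fb) (ω : Config E) :
    (ω fo = false → ω fb = false → ω = Function.update (Function.update ω fo false) fb false) ∧
      (ω fo = false → ω fb = true →
        ω = Function.update (Function.update (Function.update ω fo false) fb false) fb true) ∧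
      (ω fo = true → ω fb = false →
        ω = Function.update (Function.update (Function.update ω fo false) fb false) fo true) ∧
      (ω fo = true → ω fb = true →
        ω = Function.update
          (Function.update (Function.update (Function.update ω fo false) fb false) fo true) fb true) := by
  have hrec := eq_update_update_closeTwo fo fb ω hne
  have hσo : Function.update (Function.update ω fo false) fb false fo = false :=
    closeTwo_apply_fo fo fb ω hne
  have hσb : Function.update (Function.update ω fo false) fb false fb = false :=
    closeTwo_apply_fb fo fb ω
  have hσo' : Function.update (Function.update (Function.update ω fo false) fb false) fo false =
      Function.update (Function.update ω fo false) fb false :=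
    Function.update_eq_self_iff.2 hσo.symm
  have hσb' : Function.update (Function.update (Function.update ω fo false) fb false) fb false =
      Function.update (Function.update ω fo false) fb false :=
    Function.update_eq_self_iff.2 hσb.symm
  have hσob : Function.update
      (Function.update (Function.update (Function.update ω fo false) fb false) fo true) fb false =
      Function.update (Function.update (Function.update ω fo false) fb false) fo true :=
    Function.update_eq_self_iff.2 (by rw [Function.update_of_ne hne.symm]; exact hσb.symm)
  refine ⟨fun ho hb => ?_, fun ho hb => ?_, fun ho hb => ?_, fun ho hb => ?_⟩
  · rw [ho, hb, hσo', hσb'] at hrec; exact hrec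
  · rw [ho, hb, hσo'] at hrec; exact hrec
  · rw [ho, hb, hσob] at hrec; exact hrec
  · rw [ho, hb] at hrec; exact hrec

omit [Fintype E] [Fintype V] [DecidableEq V] in
/-- **The two-route mark**: with `fo = {v, o}`, `fb = {v, b}` the only edges at `v` and `v ∉ {a₁, o, b}`,
`a₁ ↔ o ⟺ (a₁ ↔ o off v) ∨ (fo ∧ fb ∧ a₁ ↔ b off v)`. -/
theorem conn_twoRoute_o (hfo : ends fo = s(v, o)) (hfb : ends fb = s(v, b))
    (hv : ∀ e, v ∈ ends e → e = fo ∨ e = fb) (hne : fo ≠ fb) (hav : a₁ ≠ v) (hov : o ≠ v)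
    (hbv : b ≠ v) (ω : Config E) :
    Conn ends ω a₁ o ↔ Conn ends (Function.update (Function.update ω fo false) fb false) a₁ o ∨
      (ω fo = true ∧ ω fb = true ∧
        Conn ends (Function.update (Function.update ω fo false) fb false) a₁ b) := by
  have hiso := closeTwo_isolated hv hne ω
  have R := eq_of_coins hne ω
  have Pb := conn_pendant_update hfb hiso hbv
  have Po := conn_pendant_update hfo hiso hov
  cases ho : ω fo <;> cases hb : ω fb
  · simp only [Bool.false_eq_true, false_and, or_false]
    conv_lhs => rw [R.1 ho hb]
  · simp only [Bool.false_eq_true, false_and, or_false]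
    conv_lhs => rw [R.2.1 ho hb]
    exact Pb.1 a₁ o hav hov
  · simp only [Bool.false_eq_true, false_and, and_false, or_false]
    conv_lhs => rw [R.2.2.1 ho hb]
    exact Po.1 a₁ o hav hov
  · simp only [true_and]
    conv_lhs => rw [R.2.2.2 ho hb]
    exact (conn_both_open hfo hfb hiso hav hov hbv).1

omit [Fintype E] [Fintype V] [DecidableEq V] in
/-- The two-route mark, the mark `b`. -/
theorem conn_twoRoute_b (hfo : ends fo = s(v, o)) (hfb : ends fb = s(v, b))
    (hv : ∀ e, v ∈ ends e → e = fo ∨ e = fb) (hne : fo ≠ fb) (hav : a₁ ≠ v) (hov : o ≠ v)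
    (hbv : b ≠ v) (ω : Config E) :
    Conn ends ω a₁ b ↔ Conn ends (Function.update (Function.update ω fo false) fb false) a₁ b ∨
      (ω fo = true ∧ ω fb = true ∧
        Conn ends (Function.update (Function.update ω fo false) fb false) a₁ o) := by
  have hiso := closeTwo_isolated hv hne ω
  have R := eq_of_coins hne ω
  have Pb := conn_pendant_update hfb hiso hbv
  have Po := conn_pendant_update hfo hiso hov
  cases ho : ω fo <;> cases hb : ω fb
  · simp only [Bool.false_eq_true, false_and, or_false]
    conv_lhs => rw [R.1 ho hb]
  · simp only [Bool.false_eq_true, false_and, or_false]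
    conv_lhs => rw [R.2.1 ho hb]
    exact Pb.1 a₁ b hav hbv
  · simp only [Bool.false_eq_true, false_and, and_false, or_false]
    conv_lhs => rw [R.2.2.1 ho hb]
    exact Po.1 a₁ b hav hbv
  · simp only [true_and]
    conv_lhs => rw [R.2.2.2 ho hb]
    exact (conn_both_open hfo hfb hiso hav hov hbv).2.1

omit [Fintype E] [Fintype V] [DecidableEq V] in
/-- The two-route mark, the mark `v` itself: `a₁ ↔ v ⟺ (fo ∧ a₁ ↔ o off v) ∨ (fb ∧ a₁ ↔ b off v)`. -/
theorem conn_twoRoute_v (hfo : ends fo = s(v, o)) (hfb : ends fb = s(v, b))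
    (hv : ∀ e, v ∈ ends e → e = fo ∨ e = fb) (hne : fo ≠ fb) (hav : a₁ ≠ v) (hov : o ≠ v)
    (hbv : b ≠ v) (ω : Config E) :
    Conn ends ω a₁ v ↔
      (ω fo = true ∧ Conn ends (Function.update (Function.update ω fo false) fb false) a₁ o) ∨
      (ω fb = true ∧ Conn ends (Function.update (Function.update ω fo false) fb false) a₁ b) := by
  have hiso := closeTwo_isolated hv hne ω
  have R := eq_of_coins hne ω
  have Pb := conn_pendant_update hfb hiso hbv
  have Po := conn_pendant_update hfo hiso hov
  cases ho : ω fo <;> cases hb : ω fb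
  · conv_lhs => rw [R.1 ho hb]
    simp only [Bool.false_eq_true, false_and, or_self, iff_false]
    exact fun h => hav (eq_of_conn_of_isolated hiso (conn_symm h))
  · simp only [Bool.false_eq_true, false_and, true_and, false_or]
    conv_lhs => rw [R.2.1 ho hb]
    exact ⟨fun h => conn_symm ((Pb.2 a₁ hav).1 (conn_symm h)),
      fun h => conn_symm ((Pb.2 a₁ hav).2 (conn_symm h))⟩
  · simp only [Bool.false_eq_true, false_and, true_and, or_false]
    conv_lhs => rw [R.2.2.1 ho hb]
    exact ⟨fun h => conn_symm ((Po.2 a₁ hav).1 (conn_symm h)),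
      fun h => conn_symm ((Po.2 a₁ hav).2 (conn_symm h))⟩
  · simp only [true_and]
    conv_lhs => rw [R.2.2.2 ho hb]
    exact (conn_both_open hfo hfb hiso hav hov hbv).2.2

end Conn

end CrossAPrimeVMarkedTwoRoute

end Summit.Ventures.PercRepro2
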